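import Summits.KontsevichZagierPeriods.Zeta5Search.Brown8.LiveConeStable
import Summits.KontsevichZagierPeriods.Zeta5Search.Brown8.LeadingCoefficient
import Literature.NumberTheory.Irrationality.BrownZudilin2022.DescentToZetaThree
import Summits.KontsevichZagierPeriods.Zeta5Search.WedgeDictionaryAssemblyGlue

/-!
# The residue orbit of Brown–Zudilin's NON-LIVE cone: involutions, non-liveness transport, parities (fam-brown8 GEN 14 companion)

HONEST FRAMING: systematic search; no irrationality claim unless certified.  Nothing in this file is about irrationality
or about `ζ(5)` records.  It is the integer-linear / combinatorial skeleton of THEOREM 6 of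
`run/shared/lean/pub/pub-zeta5/families/brown8/RATIONAL-FACES.md` §4.6 (the '⇒' half of the rationality criterion,
Conjecture R, on the residue orbit): there, the analytic inputs are Brown–Zudilin's (22) restricted to the residue range
(`BrownZudilin2022.descent22`), the Rhin–Viola decomposition `J₃ = 2Aζ(3) − B` (NOT typed in the tree), (27) per generator
(`BrownZudilin2022.invariance_of_converges'`, composed along convergent chains by `XStarCover.normalisedIntegral'_chain`) and
`ζ(2) ∉ ℚ`; what the kernel checks here is everything ELSE that the proof uses about the exponent vectors.

## What is proved

* `applyGen_applyGen`: the five generators `i₁, p₀₁, p₁₂, h, h'` of BZ's group `G` (Sect. 7) are involutions on `ℤ⁸`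
  (the tree's `WedgeDictionary.genI1_invol`, …, `WedgeDictionary.genHp_invol`, reused — filing-lane dedup edit);
  `applyWord_reverse`: the reversed word undoes a word.
* `not_liveBZ_applyWord_of_chain`: along a CONVERGENT chain, NON-liveness is transported to the end point (if the end point were
  live, the reversed word — a convergent chain from a live convergent vector by `live_chain` — would make the start live);
  `QOf_applyWord_eq_zero_of_chain`: hence BZ's leading coefficient `Q` (17) vanishes at the end point too.
* `qSum_applyGen_mod_two`, `pSum_applyGen_mod_two`, `qSum_applyWord_mod_two`, `pSum_applyWord_mod_two`: the parities of
  `q₁+⋯+q₅` and of `p₀+⋯+p₆` are `G`-invariant (the sign law `sign P̂ = −(−1)^{Σq}` of GEN 14 and BZ's `sign Q = (−1)^{Σp}` are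
  class functions); `topWeight_sign_parity`: `p₄+p₅+p₆+(p₄+q₄) ≡ q₁+⋯+q₅ (mod 2)` identically — the sign of the top weight of (22)
  is the sign law.
* `SingleTermResidue` (decidable): the single-term residue region `S` of THEOREM 6; `ResidueOrbitCovered a`: some convergent chain
  from `a` ends in `S`; four `decide`d instances (words of length 0, 1, 2, 5).
-/

namespace Summit.KontsevichZagierPeriods.Zeta5Search.Families.Cellular

open Literature.NumberTheory.Irrationality
open Literature.NumberTheory.Irrationality.BrownZudilin2022
open XStarCover

/-! ### The generators are involutions (tree: `WedgeDictionary.gen*_invol`) -/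

/-- Every generator of `G` is an involution. -/
theorem applyGen_applyGen (i : Fin 5) (a : Fin 8 → ℤ) : applyGen i (applyGen i a) = a := by
  fin_cases i
  · exact WedgeDictionary.genI1_invol a
  · exact WedgeDictionary.genP01_invol a
  · exact WedgeDictionary.genP12_invol a
  · exact WedgeDictionary.genH_invol a
  · exact WedgeDictionary.genHp_invol a

/-- Words compose by concatenation (`applyWord` applies the head first). -/
theorem applyWord_append (v w : List (Fin 5)) (a : Fin 8 → ℤ) :
    applyWord (v ++ w) a = applyWord w (applyWord v a) := by
  induction v generalizing a with
  | nil => rfl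
  | cons i v ih => simp [applyWord, ih]

/-- The reversed word undoes the word. -/
theorem applyWord_reverse (w : List (Fin 5)) (a : Fin 8 → ℤ) : applyWord w.reverse (applyWord w a) = a := by
  induction w generalizing a with
  | nil => rfl
  | cons i w ih => simp [applyWord, List.reverse_cons, applyWord_append, ih, applyGen_applyGen]

/-! ### Non-liveness is transported along convergent chains -/

/-- Along a convergent chain from a NON-live vector the end point is non-live. -/
theorem not_liveBZ_applyWord_of_chain (w : List (Fin 5)) (a : Fin 8 → ℤ) (hw : ConvergentChain w a)
    (hl : ¬ LiveBZ a) : ¬ LiveBZ (applyWord w a) := by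
  intro hlive
  have h := (applyWord_live w.reverse (applyWord w a) (converges_last_of_convergentChain w a hw) hlive).2
  rw [applyWord_reverse] at h
  exact hl h

/-- Hence BZ's leading coefficient `Q` (17) vanishes at the end point of a convergent chain from a non-live vector. -/
theorem QOf_applyWord_eq_zero_of_chain (w : List (Fin 5)) (a : Fin 8 → ℤ) (hw : ConvergentChain w a)
    (hl : ¬ LiveBZ a) : QOf (applyWord w a) = 0 :=
  QOf_eq_zero_of_not_liveBZ _ (converges_last_of_convergentChain w a hw) (not_liveBZ_applyWord_of_chain w a hw hl)

/-! ### Parities of `Σ q` and `Σ p` are `G`-invariant -/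

/-- `q₁+q₂+q₃+q₄+q₅` of (11). -/
def qSum (a : Fin 8 → ℤ) : ℤ := qOf a 0 + qOf a 1 + qOf a 2 + qOf a 3 + qOf a 4

/-- `p₀+p₁+⋯+p₆` of (11). -/
def pSum (a : Fin 8 → ℤ) : ℤ := pOf a 0 + pOf a 1 + pOf a 2 + pOf a 3 + pOf a 4 + pOf a 5 + pOf a 6

/-- `qSum` in closed form. -/
theorem qSum_eq (a : Fin 8 → ℤ) : qSum a = 2 * a 0 + a 1 - a 2 + a 3 + 2 * a 4 := by
  simp [qSum, qOf]; ring

/-- `pSum` in closed form. -/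
theorem pSum_eq (a : Fin 8 → ℤ) :
    pSum a = a 0 + 3 * a 1 + 3 * a 2 - 2 * a 3 + a 4 + 6 * a 5 + a 6 - 5 * a 7 := by
  simp [pSum, pOf]; ring

/-- Generator `0` preserves `Σ q (mod 2)`. -/
theorem qSum_gen0 (a : Fin 8 → ℤ) : (qSum (applyGen 0 a) - qSum a) % 2 = 0 := by
  rw [qSum_eq, qSum_eq]; simp only [applyGen_0, genI1, Matrix.cons_val]; omega
/-- Generator `1` preserves `Σ q (mod 2)`. -/
theorem qSum_gen1 (a : Fin 8 → ℤ) : (qSum (applyGen 1 a) - qSum a) % 2 = 0 := by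
  rw [qSum_eq, qSum_eq]; simp only [applyGen_1, genP01, Matrix.cons_val]; omega
/-- Generator `2` preserves `Σ q (mod 2)`. -/
theorem qSum_gen2 (a : Fin 8 → ℤ) : (qSum (applyGen 2 a) - qSum a) % 2 = 0 := by
  rw [qSum_eq, qSum_eq]; simp only [applyGen_2, genP12, Matrix.cons_val]; omega
/-- Generator `3` preserves `Σ q (mod 2)`. -/
theorem qSum_gen3 (a : Fin 8 → ℤ) : (qSum (applyGen 3 a) - qSum a) % 2 = 0 := by
  rw [qSum_eq, qSum_eq]; simp only [applyGen_3, genH, Matrix.cons_val]; omega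
/-- Generator `4` preserves `Σ q (mod 2)`. -/
theorem qSum_gen4 (a : Fin 8 → ℤ) : (qSum (applyGen 4 a) - qSum a) % 2 = 0 := by
  rw [qSum_eq, qSum_eq]; simp only [applyGen_4, genH', Matrix.cons_val]; omega

/-- Each generator preserves `Σ q (mod 2)`. -/
theorem qSum_applyGen_mod_two (i : Fin 5) (a : Fin 8 → ℤ) : (qSum (applyGen i a) - qSum a) % 2 = 0 := by
  fin_cases i
  · exact qSum_gen0 a
  · exact qSum_gen1 a
  · exact qSum_gen2 a
  · exact qSum_gen3 a
  · exact qSum_gen4 a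

/-- Generator `0` preserves `Σ p (mod 2)`. -/
theorem pSum_gen0 (a : Fin 8 → ℤ) : (pSum (applyGen 0 a) - pSum a) % 2 = 0 := by
  rw [pSum_eq, pSum_eq]; simp only [applyGen_0, genI1, Matrix.cons_val]; omega
/-- Generator `1` preserves `Σ p (mod 2)`. -/
theorem pSum_gen1 (a : Fin 8 → ℤ) : (pSum (applyGen 1 a) - pSum a) % 2 = 0 := by
  rw [pSum_eq, pSum_eq]; simp only [applyGen_1, genP01, Matrix.cons_val]; omega
/-- Generator `2` preserves `Σ p (mod 2)`. -/
theorem pSum_gen2 (a : Fin 8 → ℤ) : (pSum (applyGen 2 a) - pSum a) % 2 = 0 := by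
  rw [pSum_eq, pSum_eq]; simp only [applyGen_2, genP12, Matrix.cons_val]; omega
/-- Generator `3` preserves `Σ p (mod 2)`. -/
theorem pSum_gen3 (a : Fin 8 → ℤ) : (pSum (applyGen 3 a) - pSum a) % 2 = 0 := by
  rw [pSum_eq, pSum_eq]; simp only [applyGen_3, genH, Matrix.cons_val]; omega
/-- Generator `4` preserves `Σ p (mod 2)`. -/
theorem pSum_gen4 (a : Fin 8 → ℤ) : (pSum (applyGen 4 a) - pSum a) % 2 = 0 := by
  rw [pSum_eq, pSum_eq]; simp only [applyGen_4, genH', Matrix.cons_val]; omega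

/-- Each generator preserves `Σ p (mod 2)`. -/
theorem pSum_applyGen_mod_two (i : Fin 5) (a : Fin 8 → ℤ) : (pSum (applyGen i a) - pSum a) % 2 = 0 := by
  fin_cases i
  · exact pSum_gen0 a
  · exact pSum_gen1 a
  · exact pSum_gen2 a
  · exact pSum_gen3 a
  · exact pSum_gen4 a

/-- Every word preserves `Σ q (mod 2)`. -/
theorem qSum_applyWord_mod_two (w : List (Fin 5)) : ∀ a : Fin 8 → ℤ, (qSum (applyWord w a) - qSum a) % 2 = 0 := by
  induction w with
  | nil => intro a; simp [applyWord]
  | cons i w ih =>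
    intro a
    have h1 := ih (applyGen i a)
    have h2 := qSum_applyGen_mod_two i a
    simp only [applyWord]
    omega

/-- Every word preserves `Σ p (mod 2)`. -/
theorem pSum_applyWord_mod_two (w : List (Fin 5)) : ∀ a : Fin 8 → ℤ, (pSum (applyWord w a) - pSum a) % 2 = 0 := by
  induction w with
  | nil => intro a; simp [applyWord]
  | cons i w ih =>
    intro a
    have h1 := ih (applyGen i a)
    have h2 := pSum_applyGen_mod_two i a
    simp only [applyWord]
    omega

/-- The sign `(−1)^{p₄+p₅+p₆+k}` of the TOP weight `k = p₄+q₄` of (22) equals `(−1)^{q₁+⋯+q₅}`, identically in `a`. -/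
theorem topWeight_sign_parity (a : Fin 8 → ℤ) :
    (pOf a 4 + pOf a 5 + pOf a 6 + (pOf a 4 + qOf a 3) - qSum a) % 2 = 0 := by
  rw [qSum_eq]; simp only [pOf, qOf, Matrix.cons_val]; omega

/-! ### The single-term residue region and the residue orbit -/

/-- The SINGLE-TERM RESIDUE REGION `S` of THEOREM 6: the hypotheses of `descent22` (twelve parameters `≥ 0`, residue range
`p₄+q₄ ≤ p₃`, provisos `J3TermsConverge`) together with "exactly one weight of (22) is non-zero": `max(p₄,p₅,p₆) = p₄+q₄`
(the support of `w22` is `[max(p₄,p₅,p₆), min(p₄+q₄, p₅+q₅)]` and `p₅+q₅ = p₃ ≥ p₄+q₄` by (19)). -/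
def SingleTermResidue (a : Fin 8 → ℤ) : Prop :=
  Converges a ∧ (∀ i, 0 ≤ pOf a i) ∧ (∀ j, 0 ≤ qOf a j) ∧ pOf a 4 + qOf a 3 ≤ pOf a 3 ∧
    J3TermsConverge (pOf a) (qOf a) ∧ max (max (pOf a 4) (pOf a 5)) (pOf a 6) = pOf a 4 + qOf a 3

/-- `SingleTermResidue` is decidable (linear integer conditions). -/
noncomputable instance (a : Fin 8 → ℤ) : Decidable (SingleTermResidue a) := by
  unfold SingleTermResidue; infer_instance

/-- `a` is COVERED BY THE RESIDUE ORBIT: some convergent chain in the generators of `G` takes `a` into `S`. -/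
def ResidueOrbitCovered (a : Fin 8 → ℤ) : Prop := ∃ w : List (Fin 5), ConvergentChain w a ∧ SingleTermResidue (applyWord w a)

/-- `a = (0,0,0,0,0,1,1,0)` (`I(a) = 2ζ(2) − 3` up to the census normalisation: `P̂ = −1/2`) lies in `S` itself (empty word). -/
example : ResidueOrbitCovered ![0, 0, 0, 0, 0, 1, 1, 0] := ⟨[], by decide, by decide⟩

/-- Its mirror `a = (0,0,0,0,0,0,1,0)` is NOT in `S` (`p₄+q₄ = 1 > p₃ = 0`) but `i₁ a = (0,0,0,0,0,1,0,1)` is (word `[0]`). -/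
example : ¬ SingleTermResidue ![0, 0, 0, 0, 0, 0, 1, 0] ∧ ResidueOrbitCovered ![0, 0, 0, 0, 0, 0, 1, 0] :=
  ⟨by decide, ⟨[0], by decide, by decide⟩⟩

/-- `a = (1,1,1,1,2,1,3,2)` (a ζ(2)-point of the GEN 12 census) reaches `S` at `(0,1,1,1,1,5,3,4)` by the word `i₁ ∘ h'`
(`applyWord [4, 0]`: `h'` first, then `i₁`); `a = (0,0,0,0,1,1,2,0)` needs the word `[0,4,0,4,0]` of length five. -/
example : ResidueOrbitCovered ![1, 1, 1, 1, 2, 1, 3, 2] := ⟨[4, 0], by decide, by decide⟩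

example : ResidueOrbitCovered ![0, 0, 0, 0, 1, 1, 2, 0] := ⟨[0, 4, 0, 4, 0], by decide, by decide⟩

/-- On the residue orbit of a non-live vector the end point is a non-live point of `S` (where THEOREM 6's single-term lemma applies). -/
theorem residueOrbit_endpoint (a : Fin 8 → ℤ) (hl : ¬ LiveBZ a) (w : List (Fin 5)) (hw : ConvergentChain w a)
    (hS : SingleTermResidue (applyWord w a)) :
    SingleTermResidue (applyWord w a) ∧ QOf (applyWord w a) = 0 ∧ (qSum (applyWord w a) - qSum a) % 2 = 0 :=
  ⟨hS, QOf_applyWord_eq_zero_of_chain w a hw hl, qSum_applyWord_mod_two w a⟩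

end Summit.KontsevichZagierPeriods.Zeta5Search.Families.Cellular
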